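import Literature.AlgebraicGeometry.Motives.HodgeThetaSymplecticIdeal
import HarnessLib

/-!
# `𝔰𝔭₄` is simple and centre-free, in the Siegel block form: a non-zero ideal of `𝔰𝔭(M, ω)` with Lagrangian eigen-planes
# is everything, and a skew operator commuting with `𝔰𝔭(M, ω)` vanishes

Family `hodge`, layer `Literature/AlgebraicGeometry/Motives` (complex symplectic linear algebra; no Hodge theory beyond the namespace);
THEOREMS ONLY (no definition, no named fact; D-0026).  Research context: cell `pub-hodgecm2` (COR-CM), seat `b27`, count-neutral lane
MT-RANK ladder, rung `t = 10e + 1` (real multiplication of relative dimension two): the Lie-theoretic input «`𝔰𝔭₄(ℂ)` is simple» of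
the Goursat step over the real places, in the elementary form used by the tree (`HodgeThetaSymplecticIdeal`: a non-zero ideal contains
the grading operator `T`; `HodgeThetaSubalgebraSymplecticRankFour`: the core theorem `SymplecticTheta.core_of_irreducible`).

SETTING (Goodman–Wallach §2.1.2).  `ω` a nondegenerate alternating form on a finite-dimensional complex `M`; `T` an `ω`-skew involution
whose eigenspaces `P` (`+1`), `Q` (`−1`) are PLANES (so `dim M = 4`); an IDEAL is a `ℂ`-subspace `I ⊆ End(M)` of `ω`-skew operators
with `[Z, I] ⊆ I` for every `ω`-skew `Z`.

* **`SymplecticIdeal.eq_bot_or_top_of_stable_of_theta_mem`** — a subspace of `M` stable under an ideal `I ∋ T` is `0` or `M` (the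
  rank-one root operators `ω(a, ·) ⊗ a`, `a ∈ P ∪ Q`, lie in `I` as `∓½ [ω(a,·) ⊗ a, T]`, and with the `ω`-duality of `P` and `Q` they
  move any non-zero vector of `U` onto all of `P` and `Q`; any dimensions).
* **`SymplecticIdeal.mem_of_ne_bot`** — a NON-ZERO ideal contains every `ω`-skew operator (planes): it contains `T`
  (`SymplecticIdeal.theta_mem_of_ne_bot`), acts irreducibly, and the core theorem for `±T` gives `𝔲^± ⊕ 𝔤𝔩(P) ⊆ I` («`𝔰𝔭₄` is simple»,
  Humphreys §19.1 / Goodman–Wallach §2.5.3, without root systems).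
* **`SymplecticIdeal.eq_zero_of_forall_bracket_eq_zero`** — an `ω`-skew `Z` with `[W, Z] = 0` for all `ω`-skew `W` is `0` («`𝔰𝔭₄` has
  trivial centre»: `ℂ Z` would be a non-zero ideal, hence everything, but `T` is invertible while `ω(p, ·) ⊗ p` is nilpotent and non-zero).

## References

* [GoodmanWallachGTM255] R. Goodman, N. R. Wallach, *Symmetry, Representations, and Invariants*, GTM 255, §2.1.2 (Siegel block form of
  `𝔰𝔭`), §2.5.3 (simplicity of the classical Lie algebras). [cite: GoodmanWallachGTM255, §2.1.2 and §2.5.3]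
* [Humphreys1972] J. E. Humphreys, GTM 9 (1972), §1.2 (`𝔰𝔭_{2ℓ}`), §19.1. [cite: Humphreys1972, §1.2 and §19.1]
* [MoonenZarhin1999LowDim] B. Moonen, Yu. G. Zarhin, Math. Ann. 315 (1999), §3 (3.1) (Goursat with simple factors). [cite: MoonenZarhin1999LowDim, §3 (3.1)]
-/

noncomputable section

namespace Literature.AlgebraicGeometry.Motives

namespace HodgeStructure

section RankFour

variable {M : Type*} [AddCommGroup M] [Module ℂ M]

/-- **A subspace stable under an ideal of `𝔰𝔭(M, ω)` containing `T` is `0` or `M`** (any dimensions, `P ≠ 0`).  The rank-one root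
operators `R_a = ω(a, ·) ⊗ a` (`a ∈ P` or `a ∈ Q`) satisfy `[R_a, T] = ∓2 R_a`, so lie in the ideal; a non-zero stable `U` contains a
non-zero vector of `P` or of `Q` (grading by `T ∈ I`), and then `R_p q = ω(p, q) p`, `R_q p = ω(q, p) q` together with the `ω`-duality
of `P` and `Q` sweep out `P ⊆ U` and `Q ⊆ U`. [cite: GoodmanWallachGTM255, §2.1.2] [cite: Humphreys1972, §1.2] -/
theorem SymplecticIdeal.eq_bot_or_top_of_stable_of_theta_mem (ω : LinearMap.BilinForm ℂ M) (hωnd : ω.Nondegenerate)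
    (hωalt : ∀ x y, ω x y = -ω y x) {T : Module.End ℂ M} (hTskew : ∀ x y, ω (T x) y + ω x (T y) = 0)
    {P Q : Submodule ℂ M} (hP : ∀ x ∈ P, T x = x) (hQ : ∀ x ∈ Q, T x = -x) (hPmem : ∀ v, (2 : ℂ)⁻¹ • (v + T v) ∈ P)
    (hQmem : ∀ v, (2 : ℂ)⁻¹ • (v - T v) ∈ Q) (hP0 : P ≠ ⊥) (I : Submodule ℂ (Module.End ℂ M))
    (hI : ∀ Z : Module.End ℂ M, (∀ x y, ω (Z x) y + ω x (Z y) = 0) → ∀ Y ∈ I, Z * Y - Y * Z ∈ I) (hTI : T ∈ I)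
    (U : Submodule ℂ M) (hU : ∀ Z ∈ I, ∀ u ∈ U, Z u ∈ U) : U = ⊥ ∨ U = ⊤ := by
  classical
  have hPQv : ∀ v, (2 : ℂ)⁻¹ • (v + T v) + (2 : ℂ)⁻¹ • (v - T v) = v := fun v => by module
  have hdetP : ∀ x ∈ P, (∀ q ∈ Q, ω x q = 0) → x = 0 :=
    fun x hx hxQ => SymplecticIdeal.eq_zero_of_forall_Q ω hωnd hTskew hP hPmem hQmem hx hxQ
  have hdetQ : ∀ y ∈ Q, (∀ p ∈ P, ω p y = 0) → y = 0 :=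
    fun y hy hyP => SymplecticIdeal.eq_zero_of_forall_P ω hωnd hωalt hTskew hQ hPmem hQmem hy hyP
  have hωTP : ∀ a ∈ P, ∀ v, ω a (T v) = -ω a v := fun a ha v => by
    have h := hTskew a v
    rw [hP a ha] at h
    linear_combination h
  have hωTQ : ∀ a ∈ Q, ∀ v, ω a (T v) = ω a v := fun a ha v => by
    have h := hTskew a v
    rw [hQ a ha, map_neg, LinearMap.neg_apply] at h
    linear_combination h
  -- the root operators `R_a = ω(a, ·) ⊗ a` lie in `I` for `a ∈ P` and for `a ∈ Q`
  have hRskew : ∀ a : M, ∀ x y, ω ((ω a).smulRight a x) y + ω x ((ω a).smulRight a y) = 0 :=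
    fun a => SymplecticIdeal.smulRight_self_skew ω hωalt a
  have hRP : ∀ p ∈ P, (ω p).smulRight p ∈ I := by
    intro p hp
    have hbr : (ω p).smulRight p * T - T * (ω p).smulRight p = (-2 : ℂ) • (ω p).smulRight p := by
      refine LinearMap.ext fun v => ?_
      simp only [LinearMap.sub_apply, Module.End.mul_apply, LinearMap.smulRight_apply, LinearMap.smul_apply, map_smul,
        hωTP p hp, hP p hp]
      module
    have h := hI _ (hRskew p) T hTI
    rw [hbr] at h
    have h' := I.smul_mem ((-2 : ℂ)⁻¹) h
    rwa [smul_smul, inv_mul_cancel₀ (by norm_num : (-2 : ℂ) ≠ 0), one_smul] at h'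
  have hRQ : ∀ q ∈ Q, (ω q).smulRight q ∈ I := by
    intro q hq
    have hbr : (ω q).smulRight q * T - T * (ω q).smulRight q = (2 : ℂ) • (ω q).smulRight q := by
      refine LinearMap.ext fun v => ?_
      simp only [LinearMap.sub_apply, Module.End.mul_apply, LinearMap.smulRight_apply, LinearMap.smul_apply, map_smul,
        hωTQ q hq, hQ q hq]
      module
    have h := hI _ (hRskew q) T hTI
    rw [hbr] at h
    have h' := I.smul_mem ((2 : ℂ)⁻¹) h
    rwa [smul_smul, inv_mul_cancel₀ (two_ne_zero' ℂ), one_smul] at h'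
  -- sweeping: if the root operators of `A` lie in `I` and `b ∈ U` pairs non-trivially with `A`, then `A ≤ U`
  have hsweep : ∀ (A : Submodule ℂ M) (b : M), (∀ a ∈ A, (ω a).smulRight a ∈ I) → b ∈ U →
      (∃ a₀ ∈ A, ω a₀ b ≠ 0) → A ≤ U := by
    rintro A b hRA hbU ⟨a₀, ha₀A, ha₀b⟩ a haA
    have hmemU : ∀ a' ∈ A, ω a' b ≠ 0 → a' ∈ U := by
      intro a' ha' hne
      have h1 : (ω a').smulRight a' b ∈ U := hU _ (hRA a' ha') b hbU
      rw [LinearMap.smulRight_apply] at h1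
      have h2 := U.smul_mem (ω a' b)⁻¹ h1
      rwa [smul_smul, inv_mul_cancel₀ hne, one_smul] at h2
    by_cases ha : ω a b = 0
    · have h1 : a + a₀ ∈ U :=
        hmemU _ (A.add_mem haA ha₀A) (by rw [map_add, LinearMap.add_apply, ha, zero_add]; exact ha₀b)
      have h3 := U.sub_mem h1 (hmemU _ ha₀A ha₀b)
      rwa [add_sub_cancel_right] at h3
    · exact hmemU _ haA ha
  have hclaimP : ∀ q₀ ∈ Q, q₀ ∈ U → q₀ ≠ 0 → P ≤ U := by
    intro q₀ hq₀Q hq₀U hq₀0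
    refine hsweep P q₀ hRP hq₀U ?_
    by_contra h
    push Not at h
    exact hq₀0 (hdetQ q₀ hq₀Q h)
  have hclaimQ : ∀ p₁ ∈ P, p₁ ∈ U → p₁ ≠ 0 → Q ≤ U := by
    intro p₁ hp₁P hp₁U hp₁0
    refine hsweep Q p₁ hRQ hp₁U ?_
    by_contra h
    push Not at h
    exact hp₁0 (hdetP p₁ hp₁P fun q hq => by rw [hωalt, h q hq, neg_zero])
  -- a non-zero stable `U` is everything
  by_cases hU0 : U = ⊥
  · exact Or.inl hU0
  right
  obtain ⟨u, huU, hu0⟩ := (Submodule.ne_bot_iff U).1 hU0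
  have hTu : T u ∈ U := hU T hTI u huU
  have hup : (2 : ℂ)⁻¹ • (u + T u) ∈ U := U.smul_mem _ (U.add_mem huU hTu)
  have hum : (2 : ℂ)⁻¹ • (u - T u) ∈ U := U.smul_mem _ (U.sub_mem huU hTu)
  obtain ⟨p₁, hp₁P, hp₁0⟩ := (Submodule.ne_bot_iff P).1 hP0
  have hPQU : P ≤ U ∧ Q ≤ U := by
    by_cases hm : (2 : ℂ)⁻¹ • (u - T u) = 0
    · -- `u ∈ P ∩ U`
      have huP : u ∈ P := by
        have h := hPQv u
        rw [hm, add_zero] at h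
        rw [← h]
        exact hPmem u
      have hQU := hclaimQ u huP huU hu0
      obtain ⟨q₁, hq₁Q, hq₁⟩ : ∃ q₁ ∈ Q, ω u q₁ ≠ 0 := by
        by_contra h
        push Not at h
        exact hu0 (hdetP u huP h)
      have hq₁0 : q₁ ≠ 0 := fun h => hq₁ (by rw [h, map_zero])
      exact ⟨hclaimP q₁ hq₁Q (hQU hq₁Q) hq₁0, hQU⟩
    · have hPU := hclaimP _ (hQmem u) hum hm
      exact ⟨hPU, hclaimQ p₁ hp₁P (hPU hp₁P) hp₁0⟩
  rw [eq_top_iff]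
  intro v _
  rw [← hPQv v]
  exact U.add_mem (hPQU.1 (hPmem v)) (hPQU.2 (hQmem v))

/-- **«`𝔰𝔭₄` is simple»: a non-zero ideal of `𝔰𝔭(M, ω)` (Lagrangian eigen-PLANES `P`, `Q` of `T`) contains every `ω`-skew operator.**
It contains `T` (`SymplecticIdeal.theta_mem_of_ne_bot`), hence acts irreducibly on `M` (previous theorem), so the core theorem
`SymplecticTheta.core_of_irreducible` for `T` and for `−T` puts `𝔲⁺ ⊕ 𝔤𝔩(P) ⊕ 𝔲⁻` inside it.
[cite: GoodmanWallachGTM255, §2.1.2 and §2.5.3] [cite: Humphreys1972, §1.2 and §19.1] [cite: MoonenZarhin1999LowDim, §3 (3.1)] -/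
theorem SymplecticIdeal.mem_of_ne_bot [FiniteDimensional ℂ M] (ω : LinearMap.BilinForm ℂ M) (hωnd : ω.Nondegenerate)
    (hωalt : ∀ x y, ω x y = -ω y x) {T : Module.End ℂ M} (hTT : ∀ v, T (T v) = v)
    (hTskew : ∀ x y, ω (T x) y + ω x (T y) = 0) {P Q : Submodule ℂ M} (hP : ∀ x ∈ P, T x = x) (hQ : ∀ x ∈ Q, T x = -x)
    (hPmem : ∀ v, (2 : ℂ)⁻¹ • (v + T v) ∈ P) (hQmem : ∀ v, (2 : ℂ)⁻¹ • (v - T v) ∈ Q) (hP2 : Module.finrank ℂ P = 2)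
    (hQ2 : Module.finrank ℂ Q = 2) (I : Submodule ℂ (Module.End ℂ M)) (hIskew : ∀ Y ∈ I, ∀ x y, ω (Y x) y + ω x (Y y) = 0)
    (hI : ∀ Z : Module.End ℂ M, (∀ x y, ω (Z x) y + ω x (Z y) = 0) → ∀ Y ∈ I, Z * Y - Y * Z ∈ I) (hI0 : I ≠ ⊥)
    {Y : Module.End ℂ M} (hYskew : ∀ x y, ω (Y x) y + ω x (Y y) = 0) : Y ∈ I := by
  classical
  have hTI : T ∈ I := SymplecticIdeal.theta_mem_of_ne_bot ω hωnd hωalt hTT hTskew hP hQ hPmem hQmem I hIskew hI hI0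
  have hP0 : P ≠ ⊥ := by
    intro h
    rw [h, finrank_bot] at hP2
    exact absurd hP2 (by norm_num)
  have hIbr : ∀ Z ∈ I, ∀ Z' ∈ I, Z * Z' - Z' * Z ∈ I := fun Z hZ Z' hZ' => hI Z (hIskew Z hZ) Z' hZ'
  have hirr : ∀ U : Submodule ℂ M, (∀ Z ∈ I, ∀ u ∈ U, Z u ∈ U) → U = ⊥ ∨ U = ⊤ :=
    SymplecticIdeal.eq_bot_or_top_of_stable_of_theta_mem ω hωnd hωalt hTskew hP hQ hPmem hQmem hP0 I hI hTI
  -- the core theorem for `T` and for `-T`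
  have hnTI : -T ∈ I := by
    have h := I.smul_mem (-1 : ℂ) hTI
    simp only [neg_smul, one_smul] at h
    exact h
  have hnTT : ∀ v, (-T) ((-T) v) = v := fun v => by rw [LinearMap.neg_apply, LinearMap.neg_apply, map_neg, neg_neg, hTT]
  have hP' : ∀ x ∈ Q, (-T) x = x := fun x hx => by rw [LinearMap.neg_apply, hQ x hx, neg_neg]
  have hQ' : ∀ x ∈ P, (-T) x = -x := fun x hx => by rw [LinearMap.neg_apply, hP x hx]
  have hPmem' : ∀ v, (2 : ℂ)⁻¹ • (v + (-T) v) ∈ Q := fun v => by rw [LinearMap.neg_apply, ← sub_eq_add_neg]; exact hQmem v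
  have hQmem' : ∀ v, (2 : ℂ)⁻¹ • (v - (-T) v) ∈ P := fun v => by rw [LinearMap.neg_apply, sub_neg_eq_add]; exact hPmem v
  obtain ⟨hA, hB⟩ := SymplecticTheta.core_of_irreducible ω hωnd hωalt I hIbr hIskew hTI hTT (P := P) (Q := Q) hP hQ hPmem hQmem
    hP2 hQ2 hirr
  obtain ⟨hA', -⟩ := SymplecticTheta.core_of_irreducible ω hωnd hωalt I hIbr hIskew hnTI hnTT (P := Q) (Q := P) hP' hQ' hPmem'
    hQmem' hQ2 hP2 hirr
  -- grading of `Y` along `ad T` inside the skew operators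
  let 𝔰 : Submodule ℂ (Module.End ℂ M) :=
    { carrier := {Z | ∀ x y, ω (Z x) y + ω x (Z y) = 0}
      zero_mem' := fun x y => by simp
      add_mem' := by
        intro Z Z' hZ hZ' x y
        simp only [LinearMap.add_apply, map_add]
        have h1 := hZ x y
        have h2 := hZ' x y
        linear_combination h1 + h2
      smul_mem' := by
        intro c Z hZ x y
        simp only [LinearMap.smul_apply, map_smul, smul_eq_mul]
        have h1 := hZ x y
        linear_combination c * h1 }
  have hmem𝔰 : ∀ Z, Z ∈ 𝔰 ↔ ∀ x y, ω (Z x) y + ω x (Z y) = 0 := fun Z => Iff.rfl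
  have h𝔰br : ∀ Z ∈ 𝔰, ∀ Z' ∈ 𝔰, Z * Z' - Z' * Z ∈ 𝔰 := by
    intro Z hZ Z' hZ' x y
    simp only [LinearMap.sub_apply, Module.End.mul_apply, map_sub, LinearMap.sub_apply]
    have h1 := (hmem𝔰 Z).1 hZ (Z' x) y
    have h2 := (hmem𝔰 Z').1 hZ' x (Z y)
    have h3 := (hmem𝔰 Z').1 hZ' (Z x) y
    have h4 := (hmem𝔰 Z).1 hZ x (Z' y)
    linear_combination h1 - h3 + h4 - h2
  obtain ⟨Ym, hYm, Y0, hY0, Yp, hYp, hYeq, hYpP, hYpim, hYmQ, hYmim, -, -, hY0P, hY0Q⟩ :=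
    SymplecticTheta.exists_decomp 𝔰 h𝔰br ((hmem𝔰 T).2 hTskew) hTT (P := P) (Q := Q) hP hQ hPmem hQmem ((hmem𝔰 Y).2 hYskew)
  rw [hYeq]
  refine I.add_mem (I.add_mem ?_ ?_) ?_
  · exact hA' Ym ((hmem𝔰 Ym).1 hYm) hYmQ hYmim
  · exact hB Y0 ((hmem𝔰 Y0).1 hY0) hY0P hY0Q
  · exact hA Yp ((hmem𝔰 Yp).1 hYp) hYpP hYpim

/-- **«`𝔰𝔭₄` has trivial centre»**: an `ω`-skew `Z` commuting with every `ω`-skew operator is `0` (planes setting).  Otherwise `ℂ Z`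
is a non-zero ideal, hence contains `T` and the non-zero nilpotent root operator `R_p = ω(p, ·) ⊗ p` (`p ∈ P`, `p ≠ 0`): but
`T² = 1` forces `Z` invertible and then `R_p = c Z` invertible or zero — absurd. [cite: GoodmanWallachGTM255, §2.1.2 and §2.5.3]
[cite: Humphreys1972, §1.2 and §19.1] -/
theorem SymplecticIdeal.eq_zero_of_forall_bracket_eq_zero [FiniteDimensional ℂ M] (ω : LinearMap.BilinForm ℂ M)
    (hωnd : ω.Nondegenerate) (hωalt : ∀ x y, ω x y = -ω y x) {T : Module.End ℂ M} (hTT : ∀ v, T (T v) = v)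
    (hTskew : ∀ x y, ω (T x) y + ω x (T y) = 0) {P Q : Submodule ℂ M} (hP : ∀ x ∈ P, T x = x) (hQ : ∀ x ∈ Q, T x = -x)
    (hPmem : ∀ v, (2 : ℂ)⁻¹ • (v + T v) ∈ P) (hQmem : ∀ v, (2 : ℂ)⁻¹ • (v - T v) ∈ Q) (hP2 : Module.finrank ℂ P = 2)
    (hQ2 : Module.finrank ℂ Q = 2) {Z : Module.End ℂ M} (hZskew : ∀ x y, ω (Z x) y + ω x (Z y) = 0)
    (hZ : ∀ W : Module.End ℂ M, (∀ x y, ω (W x) y + ω x (W y) = 0) → W * Z - Z * W = 0) : Z = 0 := by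
  classical
  by_contra hZ0
  set I : Submodule ℂ (Module.End ℂ M) := ℂ ∙ Z with hIdef
  have hIskew : ∀ Y ∈ I, ∀ x y, ω (Y x) y + ω x (Y y) = 0 := by
    intro Y hY x y
    obtain ⟨c, rfl⟩ := Submodule.mem_span_singleton.1 hY
    simp only [LinearMap.smul_apply, map_smul, smul_eq_mul]
    have h := hZskew x y
    linear_combination c * h
  have hI : ∀ W : Module.End ℂ M, (∀ x y, ω (W x) y + ω x (W y) = 0) → ∀ Y ∈ I, W * Y - Y * W ∈ I := by
    intro W hW Y hY
    obtain ⟨c, rfl⟩ := Submodule.mem_span_singleton.1 hY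
    rw [mul_smul_comm, smul_mul_assoc, ← smul_sub, hZ W hW, smul_zero]
    exact I.zero_mem
  have hI0 : I ≠ ⊥ := by
    rw [hIdef, Ne, Submodule.span_singleton_eq_bot]
    exact hZ0
  have hall := fun {Y : Module.End ℂ M} (hY : ∀ x y, ω (Y x) y + ω x (Y y) = 0) =>
    SymplecticIdeal.mem_of_ne_bot ω hωnd hωalt hTT hTskew hP hQ hPmem hQmem hP2 hQ2 I hIskew hI hI0 hY
  -- `T = c Z`, so `Z` is invertible up to the scalar `c ≠ 0`
  obtain ⟨c, hc⟩ := Submodule.mem_span_singleton.1 (hall hTskew)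
  -- a non-zero root operator `R_p ∈ I`, `R_p² = 0`
  have hP0 : P ≠ ⊥ := by
    intro h
    rw [h, finrank_bot] at hP2
    exact absurd hP2 (by norm_num)
  obtain ⟨p, hpP, hp0⟩ := (Submodule.ne_bot_iff P).1 hP0
  obtain ⟨c', hc'⟩ := Submodule.mem_span_singleton.1 (hall (SymplecticIdeal.smulRight_self_skew ω hωalt p))
  have hPP := SymplecticIdeal.isotropic_of_skew_involution ω hTskew hP
  have hR2 : (ω p).smulRight p * (ω p).smulRight p = 0 := by
    refine LinearMap.ext fun v => ?_
    simp only [Module.End.mul_apply, LinearMap.smulRight_apply, map_smul, hPP p hpP p hpP, zero_smul, smul_zero,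
      LinearMap.zero_apply]
  have hR0 : (ω p).smulRight p ≠ 0 := by
    intro h0
    have hq : ∃ q ∈ Q, ω p q ≠ 0 := by
      by_contra h
      push Not at h
      exact hp0 (SymplecticIdeal.eq_zero_of_forall_Q ω hωnd hTskew hP hPmem hQmem hpP h)
    obtain ⟨q, -, hq⟩ := hq
    have h1 := congrArg (fun f : Module.End ℂ M => f q) h0
    simp only [LinearMap.smulRight_apply, LinearMap.zero_apply, smul_eq_zero] at h1
    exact h1.elim hq hp0
  -- `T² = 1` and `R_p² = 0` are incompatible with both lying on the line `ℂ Z`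
  have hT2 : T * T = 1 := LinearMap.ext fun v => by rw [Module.End.mul_apply, hTT, Module.End.one_apply]
  have hc0 : c ≠ 0 := by
    intro h
    rw [h, zero_smul] at hc
    have h1 := congrArg (fun f : Module.End ℂ M => f p) hc
    simp only [LinearMap.zero_apply] at h1
    rw [hP p hpP] at h1
    exact hp0 h1.symm
  have hZT : Z = c⁻¹ • T := by rw [← hc, smul_smul, inv_mul_cancel₀ hc0, one_smul]
  have hRT : (ω p).smulRight p = (c' * c⁻¹) • T := by rw [← hc', hZT, smul_smul]
  have h1 : ((c' * c⁻¹) * (c' * c⁻¹)) • (1 : Module.End ℂ M) = 0 := by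
    rw [← hT2, ← smul_smul, ← smul_mul_assoc, ← mul_smul_comm, ← hRT, hR2]
  have h2 : (c' * c⁻¹) * (c' * c⁻¹) = 0 := by
    have h := congrArg (fun f : Module.End ℂ M => f p) h1
    simp only [LinearMap.smul_apply, Module.End.one_apply, LinearMap.zero_apply, smul_eq_zero] at h
    exact h.resolve_right hp0
  have h3 : c' * c⁻¹ = 0 := mul_self_eq_zero.1 h2
  rw [h3, zero_smul] at hRT
  exact hR0 hRT

end RankFour

end HodgeStructure

end Literature.AlgebraicGeometry.Motives

end
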